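import Literature.Topology.FourManifolds.StageFamilies
import Literature.Topology.FourManifolds.NullImagesSum
import Literature.Topology.FourManifolds.HomotopySmoothingChartwise
import Mathlib.MeasureTheory.Measure.Haar.InnerProductSpace
import Mathlib.Topology.MetricSpace.Thickening
import HarnessLib

/-!
# Families of maps `ℝ × M → N`: the generic perturbation step (Whitney 1936, §§8–9), general `M`

Topic `Literature/Topology/FourManifolds`; the inductive step of the general-position argument in
the tree's proof of Whitney's theorem *homotopic smooth embeddings `Mᵐ → Nⁿ` of a compact
manifold are smoothly isotopic when `n ≥ 2m + 2`* (H. Whitney, *Differentiable manifolds*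
(1936), §II Thm. 6 and §§8–9; Milnor, *Lectures on the h-cobordism theorem* (1965), Thm. 8.4 and
Remark; facts of `HomotopicEmbeddingsIsotopic.lean`).  It is the general-`M` analogue of
`GenericCircleStep.lean` (`exists_chartPerturb_stagesGoodOn`, one-parameter families of
circles).

**The step** (`Literature.Topology.FourManifolds.exists_boxPerturb_good`).  Let
`G : ℝ × M → N` be a smooth family whose stages are *good on `A`*: at the points `p = (t, u)` of
`A` the stage `G (t, ·)` has injective differential and `u` is separated from all other points
of its stage.  Let `ρ` be a smooth bump, `1` on `K`, with `tsupport ρ ⊆ R ⊆ Rc`, `R` open, `Rc`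
compact, lying over the source of the chart of `M` at `u₀` and mapped by `G` into the source of
the chart of `N` at `x`, and let finitely many compact `C i` be mapped by `G` into open `U i`.
Then for a suitable (generic, small) tuple of columns `c : Fin (m + 1) → ℝⁿ` the perturbed family
`G' = boxPerturb G x ρ φ c` (`StageFamilies.lean`: in the chart at `x`, `G p` is moved by
`ρ p • (c_last + ∑ᵢ φᵢ(p.2) cᵢ)`) is smooth, its stages are good on `A ∪ K`, it still maps each
`C i` into `U i`, and it agrees with `G` wherever `ρ` vanishes — provided `n ≥ 2m + 2`.

**Proof.**  Smallness: `‖c‖` small keeps the perturbed coordinates in the chart target and the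
perturbed points of `C i` in `U i` (margins over the compact `Rc`).  Genericity: the tuples for
which some perturbed stage differential fails to be injective, or two perturbed points of a stage
coincide, at points where the perturbation has a grip, form finitely many null sets
(`NullImagesSum.lean`: the conditions are affine in `c` with coefficients parametrised by
`(t, y, w)` resp. `(t, y, y')`, `2m + 1 < n` real variables; the second point of a coincidence
outside the box is parametrised through finitely many charts of the compact `M`); a small tuple
off these null sets exists.  Where the perturbation has no grip the hypothesis on `A` applies.
Everything here is proved; no named facts.

## References

* H. Whitney, *Differentiable manifolds*, Ann. of Math. (2) 37 (1936), 645–680, §II Thm. 6,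
  §§8–9. [Whitney1936]
* J. Milnor, *Lectures on the h-cobordism theorem* (1965), Thm. 8.4 and Remark (PDF p. 56).
  [MilnorHCobordism1965]
* M. W. Hirsch, *Differential Topology*, GTM 33 (1976), Ch. 3 §2 Thm. 2.5, Ch. 8 §1 Ex. 14.
  [HirschDT1976]
-/

open scoped Manifold ContDiff Topology
open Function Set Filter
open _root_.MeasureTheory _root_.MeasureTheory.Measure

noncomputable section

namespace Literature.Topology.FourManifolds

variable {m n : ℕ}

/-! ### A finite atlas of a compact manifold -/

section Atlas

variable {M : Type*} [TopologicalSpace M] [ChartedSpace (EuclideanSpace ℝ (Fin m)) M]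

/-- A compact manifold is covered by the chart sources of finitely many of its points.
[folklore] -/
theorem exists_finset_chart_cover [CompactSpace M] :
    ∃ F : Finset M, ∀ u : M, ∃ v ∈ F, u ∈ (chartAt (EuclideanSpace ℝ (Fin m)) v).source := by
  obtain ⟨F, hF⟩ := isCompact_univ.elim_finite_subcover
    (fun v : M => (chartAt (EuclideanSpace ℝ (Fin m)) v).source)
    (fun v => (chartAt _ v).open_source) fun u _ => mem_iUnion.2 ⟨u, mem_chart_source _ u⟩
  refine ⟨F, fun u => ?_⟩
  simpa only [mem_iUnion, exists_prop] using hF (mem_univ u)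

end Atlas

/-! ### The generic step -/

section Step

variable {M : Type*} [TopologicalSpace M] [ChartedSpace (EuclideanSpace ℝ (Fin m)) M]
  [IsManifold (𝓡 m) ∞ M]
  {N : Type*} [TopologicalSpace N] [ChartedSpace (EuclideanSpace ℝ (Fin n)) N]
  [IsManifold (𝓡 n) ∞ N]

/-- The lift of a smooth bump `ρ : ℝ × M → ℝ` through the chart at `u₀`, `(t, y) ↦ ρ (t, φ⁻¹ y)`,
is smooth on `ℝ × φ.target`. [folklore] -/
theorem contDiffOn_bump_lift {ρ : ℝ × M → ℝ} (hρ : ContMDiff (𝓘(ℝ, ℝ).prod (𝓡 m)) 𝓘(ℝ, ℝ) ∞ ρ)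
    (u₀ : M) :
    ContDiffOn ℝ ∞ (fun z : ℝ × EuclideanSpace ℝ (Fin m) => ρ (z.1, (extChartAt (𝓡 m) u₀).symm z.2))
      ((univ : Set ℝ) ×ˢ (extChartAt (𝓡 m) u₀).target) :=
  contDiffOn_of_contMDiffOn_prod_self (hρ.comp_contMDiffOn (contMDiffOn_prod_extChartAt_symm u₀))

/-- Coordinates of points of `(ℝ × ℝᵐ) × ℝᵐ` are differentiable (for the coefficient
functions of the null sets). [folklore] -/
theorem differentiable_proj_fst_snd (i : Fin m) :
    Differentiable ℝ (fun q : (ℝ × EuclideanSpace ℝ (Fin m)) × EuclideanSpace ℝ (Fin m) =>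
      EuclideanSpace.proj i q.1.2) := by
  have h : Differentiable ℝ (fun q : (ℝ × EuclideanSpace ℝ (Fin m)) × EuclideanSpace ℝ (Fin m) =>
      q.1.2) := differentiable_fst.snd
  exact (EuclideanSpace.proj i).differentiable.comp h

/-- Coordinates of points of `(ℝ × ℝᵐ) × ℝᵐ` are differentiable (for the coefficient
functions of the null sets). [folklore] -/
theorem differentiable_proj_snd (i : Fin m) :
    Differentiable ℝ (fun q : (ℝ × EuclideanSpace ℝ (Fin m)) × EuclideanSpace ℝ (Fin m) =>
      EuclideanSpace.proj i q.2) := by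
  have h : Differentiable ℝ (fun q : (ℝ × EuclideanSpace ℝ (Fin m)) × EuclideanSpace ℝ (Fin m) =>
      q.2) := differentiable_snd
  exact (EuclideanSpace.proj i).differentiable.comp h

variable [CompactSpace M] [T2Space M]

set_option maxHeartbeats 1600000 in
/-- **The generic perturbation step** (Whitney (1936), §§8–9; Hirsch (1976), Ch. 3 §2 Thm. 2.5),
for smooth families `G : ℝ × M → N`, `M` compact, `n ≥ 2m + 2`.  Hypotheses: the stages of `G`
are good on `A` (injective stage differential at the points of `A`, and the points of `A` are
separated from all other points of their stage); `ρ : ℝ × M → [0, 1]` is smooth, `= 1` on `K`,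
with `tsupport ρ ⊆ R ⊆ Rc`, `R` open, `Rc` compact, `Rc` lying over the source of the
chart of `M` at `u₀` and mapped by `G` into the source of the chart of `N` at `x`; finitely many
compact `C i` are mapped by `G` into open `U i`.  Conclusion: for some tuple of columns `c` the
perturbed family `boxPerturb G x ρ (extChartAt (𝓡 m) u₀) c` is smooth, its stages are good on
`A ∪ K`, it maps each `C i` into `U i`, and it agrees with `G` wherever `ρ` vanishes.
[cite: Whitney1936, §II Thm. 6 and §§8–9] -/
theorem exists_boxPerturb_good (hn : 2 * m + 2 ≤ n) {G : ℝ × M → N}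
    (hG : ContMDiff (𝓘(ℝ, ℝ).prod (𝓡 m)) (𝓡 n) ∞ G) {A : Set (ℝ × M)}
    (hAimm : ∀ p ∈ A, Injective (mfderiv (𝓡 m) (𝓡 n) (fun u => G (p.1, u)) p.2))
    (hAinj : ∀ p ∈ A, ∀ u', G (p.1, u') = G p → u' = p.2)
    {x : N} {u₀ : M} {ρ : ℝ × M → ℝ} (hρ : ContMDiff (𝓘(ℝ, ℝ).prod (𝓡 m)) 𝓘(ℝ, ℝ) ∞ ρ)
    (hρ0 : ∀ p, 0 ≤ ρ p) (hρ1 : ∀ p, ρ p ≤ 1) {K R Rc : Set (ℝ × M)} (hρK : ∀ p ∈ K, ρ p = 1)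
    (hRo : IsOpen R) (hsuppR : tsupport ρ ⊆ R) (hRRc : R ⊆ Rc) (hRc : IsCompact Rc)
    (hRcM : Rc ⊆ (univ : Set ℝ) ×ˢ (chartAt (EuclideanSpace ℝ (Fin m)) u₀).source)
    (hRcN : MapsTo G Rc (chartAt (EuclideanSpace ℝ (Fin n)) x).source)
    {ι : Type*} [Finite ι] {C : ι → Set (ℝ × M)} {U : ι → Set N} (hC : ∀ i, IsCompact (C i))
    (hU : ∀ i, IsOpen (U i)) (hCU : ∀ i, MapsTo G (C i) (U i)) :
    ∃ c : Fin (m + 1) → EuclideanSpace ℝ (Fin n),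
      ContMDiff (𝓘(ℝ, ℝ).prod (𝓡 m)) (𝓡 n) ∞ (boxPerturb G x ρ (extChartAt (𝓡 m) u₀) c) ∧
      (∀ p ∈ A ∪ K, Injective (mfderiv (𝓡 m) (𝓡 n)
        (fun u => boxPerturb G x ρ (extChartAt (𝓡 m) u₀) c (p.1, u)) p.2)) ∧
      (∀ p ∈ A ∪ K, ∀ u', boxPerturb G x ρ (extChartAt (𝓡 m) u₀) c (p.1, u') =
        boxPerturb G x ρ (extChartAt (𝓡 m) u₀) c p → u' = p.2) ∧
      (∀ i, MapsTo (boxPerturb G x ρ (extChartAt (𝓡 m) u₀) c) (C i) (U i)) ∧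
      ∀ p, ρ p = 0 → boxPerturb G x ρ (extChartAt (𝓡 m) u₀) c p = G p := by
  -- ### notation
  set φ := extChartAt (𝓡 m) u₀ with hφ
  set ψ := extChartAt (𝓡 n) x with hψ
  have hφsrc : φ.source = (chartAt (EuclideanSpace ℝ (Fin m)) u₀).source :=
    extChartAt_source (𝓡 m) u₀
  have hsrcR : MapsTo G R (chartAt (EuclideanSpace ℝ (Fin n)) x).source := fun p hp => hRcN (hRRc hp)
  have hRM : R ⊆ (univ : Set ℝ) ×ˢ (chartAt (EuclideanSpace ℝ (Fin m)) u₀).source :=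
    hRRc.trans hRcM
  have hρ0R : ∀ p, p ∉ R → ρ p = 0 := fun p hp => by
    by_contra h
    exact hp (hsuppR (subset_tsupport _ (mem_support.2 h)))
  have hnotK : ∀ p, ρ p = 0 → p ∉ K := fun p h hK => by
    have := hρK p hK
    rw [h] at this
    exact zero_ne_one this
  have hmemA : ∀ p, p ∈ A ∪ K → ρ p = 0 → p ∈ A := fun p hp h => hp.resolve_right (hnotK p h)
  have habsρ : ∀ p, |ρ p| ≤ 1 := fun p => abs_le.2 ⟨by linarith [hρ0 p], hρ1 p⟩
  -- ### margins
  obtain ⟨ε₀, hε₀, hε₀P⟩ := exists_pos_forall_chart_add_mem hG.continuous hRc hRcN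
    (isOpen_extChartAt_target (I := 𝓡 n) x) fun p hp =>
      (extChartAt (𝓡 n) x).map_source (by rw [extChartAt_source]; exact hRcN hp)
  have hεi : ∀ i, ∃ ε : ℝ, 0 < ε ∧ ∀ p ∈ C i ∩ Rc, ∀ y : EuclideanSpace ℝ (Fin n), ‖y‖ ≤ ε →
      extChartAt (𝓡 n) x (G p) + y ∈
        (extChartAt (𝓡 n) x).target ∩ (extChartAt (𝓡 n) x).symm ⁻¹' U i := by
    intro i
    refine exists_pos_forall_chart_add_mem hG.continuous (hC i |>.inter_right hRc.isClosed)
      (fun p hp => hRcN hp.2)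
      ((continuousOn_extChartAt_symm x).isOpen_inter_preimage (isOpen_extChartAt_target x) (hU i))
      fun p hp => ⟨(extChartAt (𝓡 n) x).map_source (by rw [extChartAt_source]; exact hRcN hp.2), ?_⟩
    rw [mem_preimage, (extChartAt (𝓡 n) x).left_inv (by rw [extChartAt_source]; exact hRcN hp.2)]
    exact hCU i hp.1
  choose εi hεi_pos hεiP using hεi
  obtain ⟨ε, hεpos, hεle0, hεlei⟩ := exists_pos_le_forall hε₀ hεi_pos
  -- ### a bound for the chart coordinates over `Rc`
  obtain ⟨Y, hY0, hY⟩ : ∃ Y : ℝ, 0 ≤ Y ∧ ∀ p ∈ Rc, ‖φ p.2‖ ≤ Y := by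
    have hcont : ContinuousOn (fun p : ℝ × M => ‖φ p.2‖) Rc := by
      refine ((continuousOn_extChartAt u₀).comp continuousOn_snd fun p hp => ?_).norm
      rw [extChartAt_source]
      exact (hRcM hp).2
    obtain ⟨Y, hY⟩ := hRc.bddAbove_image hcont
    refine ⟨max Y 0, le_max_right _ _, fun p hp => (hY ⟨p, hp, rfl⟩).trans (le_max_left _ _)⟩
  -- ### lifted functions and their differentiability
  set gL : ℝ × EuclideanSpace ℝ (Fin m) → EuclideanSpace ℝ (Fin n) := stageLift m n G u₀ x with hgLdef
  set SL : Set (ℝ × EuclideanSpace ℝ (Fin m)) := stageLiftDom m n G u₀ x with hSLdef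
  set ρL : ℝ × EuclideanSpace ℝ (Fin m) → ℝ := fun z => ρ (z.1, φ.symm z.2) with hρLdef
  set T : Set (ℝ × EuclideanSpace ℝ (Fin m)) := (univ : Set ℝ) ×ˢ φ.target with hTdef
  set PA : Set (ℝ × EuclideanSpace ℝ (Fin m)) :=
    {z | z.2 ∈ φ.target ∧ ((z.1, φ.symm z.2) : ℝ × M) ∈ R} with hPAdef
  have hTo : IsOpen T := isOpen_univ.prod (isOpen_extChartAt_target u₀)
  have hSLo : IsOpen SL := isOpen_stageLiftDom hG.continuous u₀ x
  have hPAT : PA ⊆ T := fun z hz => ⟨mem_univ _, hz.1⟩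
  have hPASL : PA ⊆ SL := fun z hz => ⟨hz.1, hsrcR hz.2⟩
  have hPAo : IsOpen PA := by
    have h := (continuousOn_prod_extChartAt_symm (m := m) u₀).isOpen_inter_preimage hTo hRo
    convert h using 1
    ext z
    simp only [hPAdef, mem_setOf_eq, mem_inter_iff, mem_prod, mem_univ, true_and,
      mem_preimage]
    exact Iff.rfl
  have hρLd' : ContDiffOn ℝ ∞ ρL T := contDiffOn_bump_lift hρ u₀
  have hρLd : DifferentiableOn ℝ ρL T := hρLd'.differentiableOn (by simp)
  have hDρLd : DifferentiableOn ℝ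
      (fun q : (ℝ × EuclideanSpace ℝ (Fin m)) × EuclideanSpace ℝ (Fin m) =>
        fderiv ℝ ρL q.1 ((0 : ℝ), q.2)) (T ×ˢ univ) := by
    have h1 : DifferentiableOn ℝ (fun q : (ℝ × EuclideanSpace ℝ (Fin m)) × EuclideanSpace ℝ (Fin m) =>
        fderiv ℝ ρL q.1) (T ×ˢ univ) :=
      ((hρLd'.fderiv_of_isOpen hTo (m := ∞) (by simp)).differentiableOn (by simp)).comp
        differentiableOn_fst fun q hq => hq.1
    exact h1.clm_apply (((differentiable_const _).prodMk differentiable_snd).differentiableOn)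
  have hgLd : DifferentiableOn ℝ gL SL := (contDiffOn_stageLift hG u₀ x).differentiableOn (by simp)
  have hDgLd := differentiableOn_fderiv_stageLift_apply hG u₀ x
  -- ### the finite atlas for the second point of a coincidence
  obtain ⟨F, hF⟩ := exists_finset_chart_cover (m := m) (M := M)
  -- ### dimensions and the measure
  set μ : Measure (Fin (m + 1) → EuclideanSpace ℝ (Fin n)) := volume with hμ
  have hdim : Module.finrank ℝ ((ℝ × EuclideanSpace ℝ (Fin m)) × EuclideanSpace ℝ (Fin m)) <
      Module.finrank ℝ (EuclideanSpace ℝ (Fin n)) := by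
    rw [Module.finrank_prod, Module.finrank_prod, Module.finrank_self, finrank_euclideanSpace_fin,
      finrank_euclideanSpace_fin]
    omega
  -- ### (A) non-injective stage differential where the perturbation has a grip
  set aA : Fin (m + 1) → (ℝ × EuclideanSpace ℝ (Fin m)) × EuclideanSpace ℝ (Fin m) → ℝ :=
    fun j q => stageCoef (fderiv ℝ ρL q.1 ((0 : ℝ), q.2)) (ρL q.1) q.1.2 q.2 j with haA
  set BadA : Set (Fin (m + 1) → EuclideanSpace ℝ (Fin n)) := {c | ∃ q ∈ PA ×ˢ (univ : Set (EuclideanSpace ℝ (Fin m))),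
    (∃ j, aA j q ≠ 0) ∧ ∑ j, aA j q • c j = -(fderiv ℝ gL q.1 ((0 : ℝ), q.2))} with hBadA
  have hBadA0 : μ BadA = 0 := by
    refine addHaar_setOf_exists_sum_smul_eq μ hdim (fun j => ?_) ((hDgLd.mono
      (prod_mono hPASL Subset.rfl)).neg)
    have hd : DifferentiableOn ℝ (fun q : (ℝ × EuclideanSpace ℝ (Fin m)) × EuclideanSpace ℝ (Fin m) =>
        fderiv ℝ ρL q.1 ((0 : ℝ), q.2)) (PA ×ˢ univ) := hDρLd.mono (prod_mono hPAT Subset.rfl)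
    have hs : DifferentiableOn ℝ (fun q : (ℝ × EuclideanSpace ℝ (Fin m)) × EuclideanSpace ℝ (Fin m) =>
        ρL q.1) (PA ×ˢ univ) := hρLd.comp differentiableOn_fst fun q hq => hPAT hq.1
    refine Fin.lastCases ?_ (fun i => ?_) j
    · simp only [haA, stageCoef_last]
      exact hd
    · simp only [haA, stageCoef_castSucc]
      exact (hd.mul (differentiable_proj_fst_snd i).differentiableOn).add
        (hs.mul (differentiable_proj_snd i).differentiableOn)
  -- ### (B) coincidence of two perturbed points of the box region
  set sh : (ℝ × EuclideanSpace ℝ (Fin m)) × EuclideanSpace ℝ (Fin m) → ℝ × EuclideanSpace ℝ (Fin m) :=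
    fun q => (q.1.1, q.2) with hsh
  have hshd : Differentiable ℝ sh :=
    (differentiable_fst.comp differentiable_fst).prodMk differentiable_snd
  set PB : Set ((ℝ × EuclideanSpace ℝ (Fin m)) × EuclideanSpace ℝ (Fin m)) :=
    {q | q.1 ∈ PA ∧ sh q ∈ PA} with hPB
  set aB : Fin (m + 1) → (ℝ × EuclideanSpace ℝ (Fin m)) × EuclideanSpace ℝ (Fin m) → ℝ :=
    fun j q => pairCoef (ρL q.1) (ρL (sh q)) q.1.2 q.2 j with haB
  set BadB : Set (Fin (m + 1) → EuclideanSpace ℝ (Fin n)) := {c | ∃ q ∈ PB,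
    (∃ j, aB j q ≠ 0) ∧ ∑ j, aB j q • c j = gL (sh q) - gL q.1} with hBadB
  have hBadB0 : μ BadB = 0 := by
    have hs1 : DifferentiableOn ℝ (fun q : (ℝ × EuclideanSpace ℝ (Fin m)) × EuclideanSpace ℝ (Fin m) =>
        ρL q.1) PB := hρLd.comp differentiableOn_fst fun q hq => hPAT hq.1
    have hs2 : DifferentiableOn ℝ (fun q : (ℝ × EuclideanSpace ℝ (Fin m)) × EuclideanSpace ℝ (Fin m) =>
        ρL (sh q)) PB := hρLd.comp hshd.differentiableOn fun q hq => hPAT hq.2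
    refine addHaar_setOf_exists_sum_smul_eq μ hdim (fun j => ?_) ?_
    · refine Fin.lastCases ?_ (fun i => ?_) j
      · simp only [haB, pairCoef_last]
        exact hs1.sub hs2
      · simp only [haB, pairCoef_castSucc]
        exact (hs1.mul (differentiable_proj_fst_snd i).differentiableOn).sub
          (hs2.mul (differentiable_proj_snd i).differentiableOn)
    · exact (hgLd.comp hshd.differentiableOn fun q hq => hPASL hq.2).sub
        (hgLd.comp differentiableOn_fst fun q hq => hPASL hq.1)
  -- ### (C) coincidence of a perturbed point of the box region with another point of the stage,
  -- ### read in the chart of `M` at `v ∈ F`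
  set PC : M → Set ((ℝ × EuclideanSpace ℝ (Fin m)) × EuclideanSpace ℝ (Fin m)) :=
    fun v => {q | q.1 ∈ PA ∧ sh q ∈ stageLiftDom m n G v x} with hPC
  set aC : Fin (m + 1) → (ℝ × EuclideanSpace ℝ (Fin m)) × EuclideanSpace ℝ (Fin m) → ℝ :=
    fun j q => pairCoef (ρL q.1) 0 q.1.2 q.2 j with haC
  set BadC : M → Set (Fin (m + 1) → EuclideanSpace ℝ (Fin n)) := fun v => {c | ∃ q ∈ PC v,
    (∃ j, aC j q ≠ 0) ∧ ∑ j, aC j q • c j = stageLift m n G v x (sh q) - gL q.1} with hBadC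
  have hBadC0 : ∀ v, μ (BadC v) = 0 := by
    intro v
    have hs1 : DifferentiableOn ℝ (fun q : (ℝ × EuclideanSpace ℝ (Fin m)) × EuclideanSpace ℝ (Fin m) =>
        ρL q.1) (PC v) := hρLd.comp differentiableOn_fst fun q hq => hPAT hq.1
    refine addHaar_setOf_exists_sum_smul_eq μ hdim (fun j => ?_) ?_
    · refine Fin.lastCases ?_ (fun i => ?_) j
      · simp only [haC, pairCoef_last, sub_zero]
        exact hs1
      · simp only [haC, pairCoef_castSucc, zero_mul, sub_zero]
        exact hs1.mul (differentiable_proj_fst_snd i).differentiableOn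
    · exact (((contDiffOn_stageLift hG v x).differentiableOn (by simp)).comp hshd.differentiableOn
        fun q hq => hq.2).sub (hgLd.comp differentiableOn_fst fun q hq => hPASL hq.1)
  have hBadC0' : μ (⋃ v ∈ F, BadC v) = 0 :=
    (measure_biUnion_null_iff F.countable_toSet).2 fun v _ => hBadC0 v
  -- ### choice of the parameter
  set O : Set (Fin (m + 1) → EuclideanSpace ℝ (Fin n)) := {c | (1 + m * Y) * ‖c‖ < ε} with hOdef
  have hOo : IsOpen O := isOpen_lt (continuous_const.mul continuous_norm) continuous_const
  have h0O : (0 : Fin (m + 1) → EuclideanSpace ℝ (Fin n)) ∈ O := by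
    simp only [hOdef, mem_setOf_eq, norm_zero, mul_zero]
    exact hεpos
  obtain ⟨c, hcO, hcBad⟩ := exists_mem_notMem_of_measure_zero μ hOo ⟨0, h0O⟩
    (measure_union_null (measure_union_null hBadA0 hBadB0) hBadC0')
  refine ⟨c, ?_⟩
  -- ### smallness consequences
  have hsmall : ∀ p : ℝ × M, ‖ρ p • affCol c (φ p.2)‖ ≤ ε := by
    intro p
    by_cases hpR : p ∈ R
    · have h1 : ‖affCol c (φ p.2)‖ ≤ (1 + m * Y) * ‖c‖ := by
        refine (norm_affCol_le c (φ p.2)).trans ?_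
        have := hY p (hRRc hpR)
        gcongr
      calc ‖ρ p • affCol c (φ p.2)‖ = |ρ p| * ‖affCol c (φ p.2)‖ := by
            rw [norm_smul, Real.norm_eq_abs]
        _ ≤ 1 * ((1 + m * Y) * ‖c‖) := by gcongr; exact habsρ p
        _ ≤ ε := by rw [one_mul]; exact (le_of_lt hcO)
    · rw [hρ0R p hpR, zero_smul, norm_zero]
      exact hεpos.le
  have htgtRc : ∀ p ∈ Rc, ψ (G p) + ρ p • affCol c (φ p.2) ∈ ψ.target := fun p hp =>
    hε₀P p hp _ ((hsmall p).trans hεle0)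
  have htgt : ∀ p ∈ R, ψ (G p) + ρ p • affCol c (φ p.2) ∈ ψ.target := fun p hp =>
    htgtRc p (hRRc hp)
  set G' : ℝ × M → N := boxPerturb G x ρ φ c with hG'def
  have hG's : ContMDiff (𝓘(ℝ, ℝ).prod (𝓡 m)) (𝓡 n) ∞ G' :=
    contMDiff_boxPerturb hG hρ hRo hsuppR hRM hsrcR htgt
  have hG'R : ∀ p ∈ R, G' p ∈ (chartAt (EuclideanSpace ℝ (Fin n)) x).source ∧
      ψ (G' p) = ψ (G p) + ρ p • affCol c (φ p.2) := fun p hp =>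
    boxPerturb_mem_source (hsrcR hp) (htgt p hp)
  have hG'off : ∀ p, p ∉ R → G' p = G p := fun p hp => boxPerturb_of_eq_zero (hρ0R p hp)
  have hG'ev : ∀ p, p ∉ R → G' =ᶠ[𝓝 p] G := fun p hp =>
    boxPerturb_eventuallyEq fun h => hp (hsuppR h)
  -- the lift of `G'` on `PA`
  have hliftPA : ∀ z ∈ PA, ((z.1, φ.symm z.2) : ℝ × M) ∈ R ∧ φ (φ.symm z.2) = z.2 := fun z hz =>
    ⟨hz.2, φ.right_inv hz.1⟩
  have hcoordL : ∀ z ∈ PA, stageLift m n G' u₀ x z = gL z + ρL z • affCol c z.2 := by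
    intro z hz
    obtain ⟨hzR, hzφ⟩ := hliftPA z hz
    have := (hG'R _ hzR).2
    rw [hzφ] at this
    exact this
  have hliftDom' : ∀ z ∈ PA, z ∈ stageLiftDom m n G' u₀ x := fun z hz =>
    ⟨hz.1, (hG'R _ (hliftPA z hz).1).1⟩
  have hfderivL : ∀ z ∈ PA, ∀ w : EuclideanSpace ℝ (Fin m),
      fderiv ℝ (stageLift m n G' u₀ x) z ((0 : ℝ), w) =
        fderiv ℝ gL z ((0 : ℝ), w) + ∑ j, aA j (z, w) • c j := by
    intro z hz w
    have hev : stageLift m n G' u₀ x =ᶠ[𝓝 z] fun z => gL z + ρL z • affCol c z.2 := by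
      filter_upwards [hPAo.mem_nhds hz] with z' hz' using hcoordL z' hz'
    rw [hev.fderiv_eq]
    have hρz : DifferentiableAt ℝ ρL z := hρLd.differentiableAt (hTo.mem_nhds (hPAT hz))
    have hgz : DifferentiableAt ℝ gL z := differentiableAt_stageLift hG (hPASL hz)
    rw [show (fun z => gL z + ρL z • affCol c z.2) = gL + fun z => ρL z • affCol c z.2 from rfl,
      fderiv_add hgz (differentiableAt_smul_affCol hρz c), _root_.add_apply,
      fderiv_smul_affCol_apply_eq_sum hρz]
  refine ⟨hG's, ?_, ?_, ?_, fun p hp => boxPerturb_of_eq_zero hp⟩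
  · -- ### injective stage differentials on `A ∪ K`
    rintro ⟨t, u⟩ hp
    by_cases hpR : ((t, u) : ℝ × M) ∈ R
    · have huφ : u ∈ φ.source := by rw [hφsrc]; exact (hRM hpR).2
      set z : ℝ × EuclideanSpace ℝ (Fin m) := (t, φ u) with hzdef
      have hzu : φ.symm z.2 = u := φ.left_inv huφ
      have hz : z ∈ PA := by
        refine ⟨φ.map_source huφ, ?_⟩
        change ((t, φ.symm (φ u)) : ℝ × M) ∈ R
        rw [φ.left_inv huφ]
        exact hpR
      have key := injective_mfderiv_stage_iff hG's (hliftDom' z hz)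
      rw [hzu] at key
      change Injective (mfderiv (𝓡 m) (𝓡 n) (fun u => G' (t, u)) u)
      refine key.2 ((injective_iff_map_eq_zero _).2 fun w hw => ?_)
      by_contra hw0
      rw [ContinuousLinearMap.coe_comp, comp_apply, ContinuousLinearMap.inr_apply,
        hfderivL z hz w] at hw
      have h1 : ∑ j, aA j (z, w) • c j = -(fderiv ℝ gL z ((0 : ℝ), w)) :=
        eq_neg_of_add_eq_zero_right hw
      by_cases hgrip : ∃ j, aA j (z, w) ≠ 0
      · exact hcBad (Or.inl (Or.inl ⟨(z, w), ⟨hz, mem_univ _⟩, hgrip, h1⟩))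
      · push Not at hgrip
        have hzero : stageCoef (fderiv ℝ ρL z ((0 : ℝ), w)) (ρL z) z.2 w = 0 := funext hgrip
        obtain ⟨-, hρw⟩ := (stageCoef_eq_zero_iff _ _ _ _).1 hzero
        have hρz : ρL z = 0 := by
          rcases smul_eq_zero.1 hρw with h | h
          · exact h
          · exact absurd h hw0
        have hρp : ρ (t, u) = 0 := by
          have : ρL z = ρ (t, φ.symm (φ u)) := rfl
          rw [this, φ.left_inv huφ] at hρz
          exact hρz
        have hpA : ((t, u) : ℝ × M) ∈ A := hmemA _ hp hρp
        -- the original stage differential is injective, but kills `w`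
        have key0 := injective_mfderiv_stage_iff hG (hPASL hz)
        rw [hzu] at key0
        have hinj0 := key0.1 (hAimm _ hpA)
        have hsum0 : ∑ j, aA j (z, w) • c j = 0 := by
          rw [Finset.sum_eq_zero]
          intro j _
          rw [hgrip j, zero_smul]
        have : fderiv ℝ gL z ((0 : ℝ), w) = 0 := by
          rw [hsum0] at h1
          exact neg_eq_zero.1 h1.symm
        have h' : ((fderiv ℝ gL z).comp
            (ContinuousLinearMap.inr ℝ ℝ (EuclideanSpace ℝ (Fin m)))) w = 0 := by
          rw [ContinuousLinearMap.coe_comp, comp_apply, ContinuousLinearMap.inr_apply, this]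
        exact hw0 ((injective_iff_map_eq_zero _).1 hinj0 w h')
    · have hev : (fun u => G' (t, u)) =ᶠ[𝓝 u] fun u => G (t, u) :=
        (hG'ev _ hpR).comp_tendsto ((Continuous.prodMk_right t).tendsto u)
      change Injective (mfderiv (𝓡 m) (𝓡 n) (fun u => G' (t, u)) u)
      rw [hev.mfderiv_eq]
      exact hAimm _ (hmemA _ hp (hρ0R _ hpR))
  · -- ### separation of the points of `A ∪ K`
    rintro ⟨t, u⟩ hp u' heq
    by_contra hne
    change G' (t, u') = G' (t, u) at heq
    have fallback : ρ (t, u) = 0 → G' (t, u') = G (t, u') → False := fun h0 h1 => by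
      have hGeq : G (t, u') = G (t, u) := by
        rw [← h1, heq]
        exact boxPerturb_of_eq_zero h0
      exact hne (hAinj _ (hmemA _ hp h0) u' hGeq)
    by_cases hpR : ((t, u) : ℝ × M) ∈ R
    · have huφ : u ∈ φ.source := by rw [hφsrc]; exact (hRM hpR).2
      set z : ℝ × EuclideanSpace ℝ (Fin m) := (t, φ u) with hzdef
      have hz : z ∈ PA := by
        refine ⟨φ.map_source huφ, ?_⟩
        change ((t, φ.symm (φ u)) : ℝ × M) ∈ R
        rw [φ.left_inv huφ]
        exact hpR
      have hρu : ρ (t, u) = ρL z := by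
        change ρ (t, u) = ρ (t, φ.symm (φ u))
        rw [φ.left_inv huφ]
      have hgLz : gL z = ψ (G (t, u)) := by
        change ψ (G (t, φ.symm (φ u))) = ψ (G (t, u))
        rw [φ.left_inv huφ]
      by_cases hp'R : ((t, u') : ℝ × M) ∈ R
      · have hu'φ : u' ∈ φ.source := by rw [hφsrc]; exact (hRM hp'R).2
        set y' : EuclideanSpace ℝ (Fin m) := φ u' with hy'def
        have hz' : ((t, y') : ℝ × EuclideanSpace ℝ (Fin m)) ∈ PA := by
          refine ⟨φ.map_source hu'φ, ?_⟩
          change ((t, φ.symm (φ u')) : ℝ × M) ∈ R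
          rw [φ.left_inv hu'φ]
          exact hp'R
        have hρu' : ρ (t, u') = ρL (t, y') := by
          change ρ (t, u') = ρ (t, φ.symm (φ u'))
          rw [φ.left_inv hu'φ]
        have hyy' : φ u ≠ y' := fun h => hne ((φ.injOn hu'φ huφ) h.symm)
        have hE : gL z + ρL z • affCol c z.2 = gL (t, y') + ρL (t, y') • affCol c y' := by
          rw [← hcoordL _ hz, ← hcoordL _ hz']
          change ψ (G' (t, φ.symm (φ u))) = ψ (G' (t, φ.symm (φ u')))
          rw [φ.left_inv huφ, φ.left_inv hu'φ, heq]
        have hE2 : ∑ j, aB j (z, y') • c j = gL (sh (z, y')) - gL z := by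
          change ∑ j, pairCoef (ρL z) (ρL (t, y')) z.2 y' j • c j = gL (t, y') - gL z
          rw [sum_pairCoef_smul_eq, sub_eq_sub_iff_add_eq_add, add_comm]
          exact hE
        by_cases hgrip : ∃ j, aB j (z, y') ≠ 0
        · exact hcBad (Or.inl (Or.inr ⟨(z, y'), ⟨hz, hz'⟩, hgrip, hE2⟩))
        · push Not at hgrip
          obtain ⟨h1, h2⟩ := eq_of_pairCoef_eq_zero (m := m) hgrip
          have hρz : ρL z = 0 := by
            by_contra hρne
            rw [← h1] at h2
            exact hyy' (smul_right_injective _ hρne h2)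
          have hρz' : ρL (t, y') = 0 := h1 ▸ hρz
          exact fallback (hρu.trans hρz) (boxPerturb_of_eq_zero (hρu'.trans hρz'))
      · have hG'p' : G' (t, u') = G (t, u') := hG'off _ hp'R
        by_cases hsrc' : G (t, u') ∈ (chartAt (EuclideanSpace ℝ (Fin n)) x).source
        · obtain ⟨v, hvF, hu'v⟩ := hF u'
          set y'' : EuclideanSpace ℝ (Fin m) := extChartAt (𝓡 m) v u' with hy''def
          have hu'v' : u' ∈ (extChartAt (𝓡 m) v).source := by rwa [extChartAt_source]
          have hq : ((z, y'') : (ℝ × EuclideanSpace ℝ (Fin m)) × EuclideanSpace ℝ (Fin m)) ∈ PC v := by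
            refine ⟨hz, (extChartAt (𝓡 m) v).map_source hu'v', ?_⟩
            change G (t, (extChartAt (𝓡 m) v).symm (extChartAt (𝓡 m) v u')) ∈ _
            rw [(extChartAt (𝓡 m) v).left_inv hu'v']
            exact hsrc'
          have hliftv : stageLift m n G v x (sh (z, y'')) = ψ (G (t, u')) := by
            change ψ (G (t, (extChartAt (𝓡 m) v).symm (extChartAt (𝓡 m) v u'))) = ψ (G (t, u'))
            rw [(extChartAt (𝓡 m) v).left_inv hu'v']
          have hE : gL z + ρL z • affCol c z.2 = ψ (G (t, u')) := by
            rw [← hcoordL _ hz]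
            change ψ (G' (t, φ.symm (φ u))) = ψ (G (t, u'))
            rw [φ.left_inv huφ, ← heq, hG'p']
          have hE2 : ∑ j, aC j (z, y'') • c j = stageLift m n G v x (sh (z, y'')) - gL z := by
            change ∑ j, pairCoef (ρL z) 0 z.2 y'' j • c j = _
            rw [sum_pairCoef_smul_eq, zero_smul, sub_zero, hliftv, ← hE, add_sub_cancel_left]
          by_cases hρne : ρL z ≠ 0
          · refine hcBad (Or.inr (mem_iUnion₂.2 ⟨v, hvF, (z, y''), hq, ⟨Fin.last m, ?_⟩, hE2⟩))
            simpa [haC] using hρne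
          · push Not at hρne
            exact fallback (hρu.trans hρne) hG'p'
        · refine hsrc' ?_
          rw [← hG'p', heq]
          exact (hG'R _ hpR).1
    · have hρu : ρ (t, u) = 0 := hρ0R _ hpR
      have hG'p : G' (t, u) = G (t, u) := hG'off _ hpR
      by_cases hp'R : ((t, u') : ℝ × M) ∈ R
      · by_cases hsrc : G (t, u) ∈ (chartAt (EuclideanSpace ℝ (Fin n)) x).source
        · have hu'φ : u' ∈ φ.source := by rw [hφsrc]; exact (hRM hp'R).2
          set z' : ℝ × EuclideanSpace ℝ (Fin m) := (t, φ u') with hz'def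
          have hz' : z' ∈ PA := by
            refine ⟨φ.map_source hu'φ, ?_⟩
            change ((t, φ.symm (φ u')) : ℝ × M) ∈ R
            rw [φ.left_inv hu'φ]
            exact hp'R
          have hρu' : ρ (t, u') = ρL z' := by
            change ρ (t, u') = ρ (t, φ.symm (φ u'))
            rw [φ.left_inv hu'φ]
          obtain ⟨v, hvF, huv⟩ := hF u
          have huv' : u ∈ (extChartAt (𝓡 m) v).source := by rwa [extChartAt_source]
          set y'' : EuclideanSpace ℝ (Fin m) := extChartAt (𝓡 m) v u with hy''def
          have hq : ((z', y'') : (ℝ × EuclideanSpace ℝ (Fin m)) × EuclideanSpace ℝ (Fin m)) ∈ PC v := by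
            refine ⟨hz', (extChartAt (𝓡 m) v).map_source huv', ?_⟩
            change G (t, (extChartAt (𝓡 m) v).symm (extChartAt (𝓡 m) v u)) ∈ _
            rw [(extChartAt (𝓡 m) v).left_inv huv']
            exact hsrc
          have hliftv : stageLift m n G v x (sh (z', y'')) = ψ (G (t, u)) := by
            change ψ (G (t, (extChartAt (𝓡 m) v).symm (extChartAt (𝓡 m) v u))) = ψ (G (t, u))
            rw [(extChartAt (𝓡 m) v).left_inv huv']
          have hE : gL z' + ρL z' • affCol c z'.2 = ψ (G (t, u)) := by
            rw [← hcoordL _ hz']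
            change ψ (G' (t, φ.symm (φ u'))) = ψ (G (t, u))
            rw [φ.left_inv hu'φ, heq, hG'p]
          have hE2 : ∑ j, aC j (z', y'') • c j = stageLift m n G v x (sh (z', y'')) - gL z' := by
            change ∑ j, pairCoef (ρL z') 0 z'.2 y'' j • c j = _
            rw [sum_pairCoef_smul_eq, zero_smul, sub_zero, hliftv, ← hE, add_sub_cancel_left]
          by_cases hρne : ρL z' ≠ 0
          · refine hcBad (Or.inr (mem_iUnion₂.2 ⟨v, hvF, (z', y''), hq, ⟨Fin.last m, ?_⟩, hE2⟩))
            simpa [haC] using hρne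
          · push Not at hρne
            exact fallback hρu (boxPerturb_of_eq_zero (hρu'.trans hρne))
        · refine hsrc ?_
          rw [← hG'p, ← heq]
          exact (hG'R _ hp'R).1
      · exact fallback hρu (hG'off _ hp'R)
  · -- ### the constraints `C i ↦ U i`
    intro i p hpC
    by_cases hρp : ρ p = 0
    · change boxPerturb G x ρ φ c p ∈ U i
      rw [boxPerturb_of_eq_zero hρp]
      exact hCU i hpC
    · have hpR : p ∈ R := by
        by_contra h
        exact hρp (hρ0R p h)
      obtain ⟨-, hyU⟩ := hεiP i p ⟨hpC, hRRc hpR⟩ _ ((hsmall p).trans (hεlei i))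
      change boxPerturb G x ρ φ c p ∈ U i
      rw [boxPerturb_eq_of_mem_source (hsrcR hpR)]
      exact hyU

end Step

end Literature.Topology.FourManifolds
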